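import Mathlib
import Summits.KontsevichZagierPeriods.KontsevichZagierPeriods.Theorems.SoloInformedKummerZetaBand
import HarnessLib
import HarnessLib.Audit

/-!
# Kummer family IV: the hyperbolic reciprocity law for the third kind, III — the two moves (s41)

Third file of THEOREM XXVIII(a) (§6quattuordecies of the residency paper; files I–II =
`SoloInformedKummerZetaKernel`, `SoloInformedKummerZetaBand`).  With the potential `Φ` and its
`b`-derivative `R(a,b)κ(a)κ(b)` of file I, this file performs the two MOVES of the
Kontsevich–Zagier calculus behind the law (`z 0 = x`, `z 1 = t`, `m, σ ∈ (0,1)` algebraic):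

* **deformation** (`soloInformed_kummerZeta_deformation`): Newton–Leibniz in `t` over the closed
  band `(0,1) × [0,σ]` (rule 3; `Φ(x,0) = 0`) and opening of the fibres (rule 1a) give
  `[(0,1)×(0,σ), R(x,t)κ(x)κ(t)] ∼ [(0,1), Φ(x,σ)]`;
* **kill** (`soloInformed_kummerZeta_killed`): Newton–Leibniz in `x` over `(0,σ) × [0,1]`
  (`Φ(t,0) = Φ(t,1) = 0`), opening of the fibres and the coordinate swap (rule 2) give
  `[(0,1)×(0,σ), R(t,x)κ(t)κ(x)] ∼ 0`.

File IV (`SoloInformedKummerZeta`) subtracts the two, inserts the certificate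
`R(x,t)κκ − R(t,x)κκ = κ(x)e(t) − e(x)κ(t)` of file I and reads off the reciprocity law.

References: M. Kontsevich, D. Zagier, *Periods* (2001), §1.2 (rules 1–3); M. Abramowitz,
I. Stegun, *Handbook of Mathematical Functions*, 17.7.6; this work (solo-informed s41).
-/

noncomputable section

open MeasureTheory Set Filter
open scoped Classical

open Literature.NumberTheory.Transcendental Literature.NumberTheory.Transcendental.KZ
open Literature.ModelTheory.ExponentialFields

namespace Summit.KontsevichZagierPeriods.KontsevichZagierPeriods.Theorems

/-! ### The deformation: Newton–Leibniz in `t` over `(0,1) × [0,σ]` -/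

/-- **Deformation move.**  For `m, σ ∈ (0,1)` algebraic there are representations
`r' = [(0,1)×(0,σ), R(x,t)κ(x)κ(t)]` and `rd = [(0,1), Φ(x,σ)]` with `r' ∼ rd`:
Newton–Leibniz in `t` (rule 3; `Φ(x,0) = 0`) and opening of the fibres (rule 1a).
[cite: KontsevichZagier2001, §1.2] [this work] -/
theorem soloInformed_kummerZeta_deformation (m σ : ℝ) (hm : m ∈ Ioo (0:ℝ) 1)
    (hma : IsAlgebraic ℚ m) (hσ : σ ∈ Ioo (0:ℝ) 1) (hσa : IsAlgebraic ℚ σ) :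
    ∃ (r' : IntegralRep 2) (rd : IntegralRep 1),
      r'.domain = {z : Fin 2 → ℝ | z 0 ∈ Ioo (0:ℝ) 1 ∧ z 1 ∈ Ioo (0:ℝ) σ} ∧
      (r'.integrand = fun z => soloInformedKummerZetaR m (z 0) (z 1) *
        ((√(1 - z 0 ^ 2))⁻¹ * (√(1 - m * z 0 ^ 2))⁻¹) *
        ((√(1 - z 1 ^ 2))⁻¹ * (√(1 - m * z 1 ^ 2))⁻¹)) ∧
      rd.domain = {x : Fin 1 → ℝ | x 0 ∈ Ioo (0:ℝ) 1} ∧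
      (rd.integrand = fun x => soloInformedKummerZetaPhi m (x 0) σ) ∧
      of r' - of rd ∈ relations := by
  have snoc0 : ∀ (x : Fin 1 → ℝ) (c : ℝ), (Fin.snoc x c : Fin 2 → ℝ) 0 = x 0 := fun _ _ => rfl
  have snoc1 : ∀ (x : Fin 1 → ℝ) (c : ℝ), (Fin.snoc x c : Fin 2 → ℝ) 1 = c := fun _ _ => rfl
  have hB : IsSemialgebraic ℚ {y : Fin 1 → ℝ | y 0 ∈ Ioo (0:ℝ) 1} :=
    BallPeeling.isSemialgebraic_posIoo
  have hBm : MeasurableSet {y : Fin 1 → ℝ | y 0 ∈ Ioo (0:ℝ) 1} :=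
    IsSemialgebraic.measurableSet_holds hB
  have h0sa : IsSemialgebraicFunOn ℚ {y : Fin 1 → ℝ | y 0 ∈ Ioo (0:ℝ) 1} (fun _ => (0:ℝ)) :=
    isSemialgebraicFunOn_const_of_isAlgebraic hB isAlgebraic_zero
  have hσsa : IsSemialgebraicFunOn ℚ {y : Fin 1 → ℝ | y 0 ∈ Ioo (0:ℝ) 1} (fun _ => σ) :=
    isSemialgebraicFunOn_const_of_isAlgebraic hB hσa
  have hband := soloInformed_legendre_isSemialgebraic_base (μ := σ) hσa
  -- semialgebraicity and integrability on the closed band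
  obtain ⟨hF, hf⟩ := soloInformed_kummerZeta_sa_two hm hma hband fun w hw => by
    rw [soloInformed_legendre_mem_base] at hw
    exact ⟨⟨by linarith [hw.1.1], hw.1.2⟩, by linarith [hw.2.1], hw.2.2.trans_lt hσ.2⟩
  have hint := soloInformed_kummerZeta_integrableOn_g hm hma hband fun w hw => by
    rw [soloInformed_legendre_mem_base] at hw
    exact ⟨hw.1, hw.2.1, hw.2.2.trans hσ.2.le⟩
  -- continuity and derivative along the fibres
  have hcont : ∀ x ∈ {y : Fin 1 → ℝ | y 0 ∈ Ioo (0:ℝ) 1},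
      ContinuousOn (fun t : ℝ => (fun w : Fin 2 → ℝ => soloInformedKummerZetaPhi m (w 0) (w 1))
        (Fin.snoc x t)) (Icc ((fun _ : Fin 1 → ℝ => (0:ℝ)) x) ((fun _ : Fin 1 → ℝ => σ) x)) := by
    intro x hx
    have h : x 0 ∈ Ioo (0:ℝ) 1 := hx
    have ha2 : x 0 ^ 2 ≤ 1 := by nlinarith [h.1, h.2]
    simp only [snoc0, snoc1]
    exact (soloInformed_kummerZetaPhi_continuousOn hm ha2).mono (Icc_subset_Icc le_rfl hσ.2.le)
  have hder : ∀ x ∈ {y : Fin 1 → ℝ | y 0 ∈ Ioo (0:ℝ) 1},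
      ∀ t ∈ Ioo ((fun _ : Fin 1 → ℝ => (0:ℝ)) x) ((fun _ : Fin 1 → ℝ => σ) x),
      HasDerivAt (fun t : ℝ => (fun w : Fin 2 → ℝ => soloInformedKummerZetaPhi m (w 0) (w 1))
        (Fin.snoc x t))
        ((fun w : Fin 2 → ℝ => soloInformedKummerZetaR m (w 0) (w 1) *
          ((√(1 - w 0 ^ 2))⁻¹ * (√(1 - m * w 0 ^ 2))⁻¹) *
          ((√(1 - w 1 ^ 2))⁻¹ * (√(1 - m * w 1 ^ 2))⁻¹)) (Fin.snoc x t)) t := by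
    intro x hx t ht
    have h : x 0 ∈ Ioo (0:ℝ) 1 := hx
    have ha2 : x 0 ^ 2 ≤ 1 := by nlinarith [h.1, h.2]
    have ht' : 0 < t ∧ t < σ := ht
    have ht2 : t ^ 2 < 1 := by nlinarith [ht'.1, ht'.2, hσ.2]
    simp only [snoc0, snoc1]
    exact soloInformed_kummerZetaPhi_hasDerivAt hm ha2 ht2
  -- the boundary function `Φ(x,σ) − Φ(x,0) = Φ(x,σ)`: semialgebraic and integrable on `(0,1)`
  have hφ : IsSemialgebraicMapOn ℚ {y : Fin 1 → ℝ | y 0 ∈ Ioo (0:ℝ) 1}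
      (fun x => (Fin.snoc x σ : Fin 2 → ℝ)) := by
    refine IsSemialgebraicMapOn.of_forall hB fun j => ?_
    induction j using Fin.lastCases with
    | last => simp only [Fin.snoc_last]; exact hσsa
    | cast i => simp only [Fin.snoc_castSucc]; exact isSemialgebraicFunOn_apply hB i
  have hmaps : MapsTo (fun x => (Fin.snoc x σ : Fin 2 → ℝ)) {y : Fin 1 → ℝ | y 0 ∈ Ioo (0:ℝ) 1}
      (KZlog.band {y : Fin 1 → ℝ | y 0 ∈ Ioo (0:ℝ) 1} (fun _ => 0) (fun _ => σ)) :=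
    fun x hx => KZlog.snoc_mem_band.2 ⟨hx, hσ.1.le, le_rfl⟩
  have hds : IsSemialgebraicFunOn ℚ {y : Fin 1 → ℝ | y 0 ∈ Ioo (0:ℝ) 1}
      (fun x => (fun w : Fin 2 → ℝ => soloInformedKummerZetaPhi m (w 0) (w 1))
          (Fin.snoc x ((fun _ : Fin 1 → ℝ => σ) x)) -
        (fun w : Fin 2 → ℝ => soloInformedKummerZetaPhi m (w 0) (w 1))
          (Fin.snoc x ((fun _ : Fin 1 → ℝ => (0:ℝ)) x))) := by
    refine (hF.comp_isSemialgebraicMapOn_holds hφ hmaps).congr fun x _ => ?_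
    simp only [Function.comp_apply, snoc0, snoc1, soloInformed_kummerZetaPhi_right_zero, sub_zero]
  have hsaσ : IsSemialgebraicFunOn ℚ {y : Fin 1 → ℝ | y 0 ∈ Ioo (0:ℝ) 1}
      (fun x => soloInformedKummerZetaPhi m (x 0) σ) := by
    refine hds.congr fun x _ => ?_
    simp only [snoc0, snoc1, soloInformed_kummerZetaPhi_right_zero, sub_zero]
  have h1m : 0 < 1 - m := by linarith [hm.2]
  have hdiσ : IntegrableOn (fun x : Fin 1 → ℝ => soloInformedKummerZetaPhi m (x 0) σ)
      {y : Fin 1 → ℝ | y 0 ∈ Ioo (0:ℝ) 1} := by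
    refine soloInformed_integrableOn_of_le_inv_sqrt_prod hB hsaσ ∅ {0} ∅ {0}
      ((1 - m)⁻¹ * (√(1 - m))⁻¹) ∅ measure_empty (fun x hx _ j => ?_) (fun x _ hc => ?_)
    · have h : x 0 ∈ Ioo (0:ℝ) 1 := hx
      fin_cases j
      exact h
    · have ha := hc 0
      have hP := soloInformed_kummerZetaPhi_abs_le hm (b := σ) ⟨ha.1.le, ha.2⟩ ⟨hσ.1.le, hσ.2.le⟩
      have hX : 0 ≤ (√(1 - x 0))⁻¹ := by positivity
      have hC : 0 ≤ (1 - m)⁻¹ * (√(1 - m))⁻¹ := by positivity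
      rw [Finset.prod_empty, Finset.prod_singleton, one_mul]
      calc |soloInformedKummerZetaPhi m (x 0) σ|
          ≤ (1 - m)⁻¹ * ((√(1 - x 0))⁻¹ * (√(1 - m))⁻¹) := hP
        _ ≤ (1 - m)⁻¹ * (√(1 - m))⁻¹ * ((√(1 - x 0))⁻¹ + (√(1 - x 0))⁻¹) := by
            nlinarith [mul_nonneg hC hX]
  have hdi : IntegrableOn
      (fun x => (fun w : Fin 2 → ℝ => soloInformedKummerZetaPhi m (w 0) (w 1))
          (Fin.snoc x ((fun _ : Fin 1 → ℝ => σ) x)) -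
        (fun w : Fin 2 → ℝ => soloInformedKummerZetaPhi m (w 0) (w 1))
          (Fin.snoc x ((fun _ : Fin 1 → ℝ => (0:ℝ)) x)))
      {y : Fin 1 → ℝ | y 0 ∈ Ioo (0:ℝ) 1} := by
    refine hdiσ.congr_fun (fun x _ => ?_) hBm
    simp only [snoc0, snoc1, soloInformed_kummerZetaPhi_right_zero, sub_zero]
  -- Newton–Leibniz in `t`, then open the fibres
  obtain ⟨rb, rd, hrbd, hrbi, hrdd, hrdi, hrel⟩ := exists_band_newtonLeibniz hB
    (fun _ => (0:ℝ)) (fun _ => σ) h0sa hσsa (fun _ _ => hσ.1.le) _ _ hF hf hcont hder hint hds hdi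
  obtain ⟨r', hr'd, hr'i, hrel'⟩ := of_sub_of_restrict_openBand_mem_relations h0sa hσsa rb hrbd
  refine ⟨r', rd, ?_, by rw [hr'i, hrbi], hrdd, ?_, ?_⟩
  · rw [hr'd]
    have h1 : (Fin.last 1 : Fin 2) = 1 := rfl
    ext z
    simp only [mem_setOf_eq, Fin.init, Fin.castSucc_zero, h1, mem_Ioo]
  · rw [hrdi]
    funext x
    simp only [snoc0, snoc1, soloInformed_kummerZetaPhi_right_zero, sub_zero]
  · have h := relations.sub_mem hrel hrel'
    have e : of r' - of rd = of rb - of rd - (of rb - of r') := by abel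
    rw [e]
    exact h

/-! ### The kill: Newton–Leibniz in `x` over `(0,σ) × [0,1]`, fibres opened, coordinates swapped -/

/-- **Fibrewise Newton–Leibniz kill** over a one-dimensional base (the `N = 1` case of
`soloInformed_legendre_kill`): if `P(y,·)` is continuous on `[0,1]` with derivative `g(y,·)` on
`(0,1)` and `P(y,1) = P(y,0)`, then `[{w | w ∘ e ∈ B' × (0,1)}, g(w ∘ e)] ∼ 0` for every
coordinate permutation `e` (rules 3, 1a, 2). [cite: KontsevichZagier2001, §1.2] [this work] -/
theorem soloInformed_kummerZeta_kill (B' : Set (Fin 1 → ℝ)) (hB' : IsSemialgebraic ℚ B')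
    (P g : (Fin 2 → ℝ) → ℝ)
    (hP : IsSemialgebraicFunOn ℚ (KZlog.band B' (fun _ => 0) (fun _ => 1)) P)
    (hg : IsSemialgebraicFunOn ℚ (KZlog.band B' (fun _ => 0) (fun _ => 1)) g)
    (hcont : ∀ y ∈ B', ContinuousOn (fun b : ℝ => P (Fin.snoc y b)) (Icc 0 1))
    (hder : ∀ y ∈ B', ∀ b ∈ Ioo (0:ℝ) 1,
      HasDerivAt (fun b : ℝ => P (Fin.snoc y b)) (g (Fin.snoc y b)) b)
    (hint : IntegrableOn g (KZlog.band B' (fun _ => 0) (fun _ => 1)))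
    (h0 : ∀ y ∈ B', P (Fin.snoc y 1) - P (Fin.snoc y 0) = 0)
    (e : Equiv.Perm (Fin 2)) :
    ∃ T : IntegralRep 2,
      T.domain = {w | (fun i => w (e i)) ∈
        {u : Fin 2 → ℝ | Fin.init u ∈ B' ∧ 0 < u (Fin.last 1) ∧ u (Fin.last 1) < 1}} ∧
      (T.integrand = fun w => g (fun i => w (e i))) ∧ of T ∈ relations := by
  have hB'm : MeasurableSet B' := IsSemialgebraic.measurableSet_holds hB'
  have h0sa : IsSemialgebraicFunOn ℚ B' (fun _ => (0:ℝ)) :=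
    isSemialgebraicFunOn_const_of_isAlgebraic hB' isAlgebraic_zero
  have h1sa : IsSemialgebraicFunOn ℚ B' (fun _ => (1:ℝ)) :=
    isSemialgebraicFunOn_const_of_isAlgebraic hB' isAlgebraic_one
  have hds : IsSemialgebraicFunOn ℚ B' (fun y => P (Fin.snoc y ((fun _ => (1:ℝ)) y)) -
      P (Fin.snoc y ((fun _ => (0:ℝ)) y))) :=
    h0sa.congr fun y hy => (h0 y hy).symm
  have hdi : IntegrableOn (fun y => P (Fin.snoc y ((fun _ => (1:ℝ)) y)) -
      P (Fin.snoc y ((fun _ => (0:ℝ)) y))) B' :=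
    integrableOn_zero.congr_fun (fun y hy => (h0 y hy).symm) hB'm
  obtain ⟨rb, rd, hrbd, hrbi, hrdd, hrdi, hrel⟩ := exists_band_newtonLeibniz hB'
    (fun _ => 0) (fun _ => 1) h0sa h1sa (fun _ _ => zero_le_one) P g hP hg hcont hder hint hds hdi
  have hrd : of rd ∈ relations := by
    refine of_mem_relations_of_eqOn_zero rd fun y hy => ?_
    rw [hrdd] at hy
    simp only [hrdi, Pi.zero_apply]
    exact h0 y hy
  have hrb : of rb ∈ relations := by
    have := relations.add_mem hrel hrd
    simpa using this
  obtain ⟨r', hr'd, hr'i, hrel'⟩ := of_sub_of_restrict_openBand_mem_relations h0sa h1sa rb hrbd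
  have hr' : of r' ∈ relations := by
    have := relations.sub_mem hrb hrel'
    simpa using this
  have hre : of (r'.reindex e) ∈ relations := by
    have := relations.sub_mem hr' (of_sub_of_reindex_mem_relations r' e)
    simpa using this
  refine ⟨r'.reindex e, ?_, ?_, hre⟩
  · rw [IntegralRep.reindex_domain, hr'd]
  · rw [IntegralRep.reindex_integrand, hr'i, hrbi]

/-- **Kill move.**  For `m, σ ∈ (0,1)` algebraic, `[(0,1)×(0,σ), R(t,x)κ(t)κ(x)] ∼ 0`
(`z 0 = x`, `z 1 = t`): `Φ(t,0) = Φ(t,1) = 0`. [cite: KontsevichZagier2001, §1.2] [this work] -/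
theorem soloInformed_kummerZeta_killed (m σ : ℝ) (hm : m ∈ Ioo (0:ℝ) 1)
    (hma : IsAlgebraic ℚ m) (hσ : σ ∈ Ioo (0:ℝ) 1) (hσa : IsAlgebraic ℚ σ) :
    ∃ T : IntegralRep 2, T.domain = {z : Fin 2 → ℝ | z 0 ∈ Ioo (0:ℝ) 1 ∧ z 1 ∈ Ioo (0:ℝ) σ} ∧
      (T.integrand = fun z => soloInformedKummerZetaR m (z 1) (z 0) *
        ((√(1 - z 1 ^ 2))⁻¹ * (√(1 - m * z 1 ^ 2))⁻¹) *
        ((√(1 - z 0 ^ 2))⁻¹ * (√(1 - m * z 0 ^ 2))⁻¹)) ∧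
      of T ∈ relations := by
  have snoc0 : ∀ (x : Fin 1 → ℝ) (c : ℝ), (Fin.snoc x c : Fin 2 → ℝ) 0 = x 0 := fun _ _ => rfl
  have snoc1 : ∀ (x : Fin 1 → ℝ) (c : ℝ), (Fin.snoc x c : Fin 2 → ℝ) 1 = c := fun _ _ => rfl
  have hl : (Fin.last 1 : Fin 2) = 1 := rfl
  have hB₂ : IsSemialgebraic ℚ {y : Fin 1 → ℝ | y 0 ∈ Ioo (0:ℝ) σ} :=
    (isSemialgebraic_setOf_const_lt_apply isAlgebraic_zero 0).inter
      (isSemialgebraic_setOf_apply_lt_const hσa 0)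
  have hmem : ∀ u : Fin 2 → ℝ, u ∈ KZlog.band {y : Fin 1 → ℝ | y 0 ∈ Ioo (0:ℝ) σ}
      (fun _ => 0) (fun _ => 1) ↔ u 0 ∈ Ioo (0:ℝ) σ ∧ 0 ≤ u 1 ∧ u 1 ≤ 1 := fun u => by
    simp only [KZlog.mem_band, mem_setOf_eq, Fin.init, Fin.castSucc_zero, hl]
  have hband : IsSemialgebraic ℚ (KZlog.band {y : Fin 1 → ℝ | y 0 ∈ Ioo (0:ℝ) σ}
      (fun _ => 0) (fun _ => 1)) :=
    KZlog.isSemialgebraic_band (isSemialgebraicFunOn_const_of_isAlgebraic hB₂ isAlgebraic_zero)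
      (isSemialgebraicFunOn_const_of_isAlgebraic hB₂ isAlgebraic_one)
  obtain ⟨hP, hg⟩ := soloInformed_kummerZeta_sa_two' hm hma hband fun u hu => by
    rw [hmem] at hu
    exact ⟨⟨by linarith [hu.1.1], hu.1.2.trans hσ.2⟩, by linarith [hu.2.1], hu.2.2⟩
  have hint := soloInformed_kummerZeta_integrableOn_g hm hma hband fun u hu => by
    rw [hmem] at hu
    exact ⟨⟨hu.1.1, hu.1.2.trans hσ.2⟩, hu.2.1, hu.2.2⟩
  have hcont : ∀ y ∈ {y : Fin 1 → ℝ | y 0 ∈ Ioo (0:ℝ) σ},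
      ContinuousOn (fun b : ℝ => (fun w : Fin 2 → ℝ => soloInformedKummerZetaPhi m (w 0) (w 1))
        (Fin.snoc y b)) (Icc 0 1) := by
    intro y hy
    have h : y 0 ∈ Ioo (0:ℝ) σ := hy
    have ha2 : y 0 ^ 2 ≤ 1 := by nlinarith [h.1, h.2, hσ.2]
    simp only [snoc0, snoc1]
    exact soloInformed_kummerZetaPhi_continuousOn hm ha2
  have hder : ∀ y ∈ {y : Fin 1 → ℝ | y 0 ∈ Ioo (0:ℝ) σ}, ∀ b ∈ Ioo (0:ℝ) 1,
      HasDerivAt (fun b : ℝ => (fun w : Fin 2 → ℝ => soloInformedKummerZetaPhi m (w 0) (w 1))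
        (Fin.snoc y b))
        ((fun w : Fin 2 → ℝ => soloInformedKummerZetaR m (w 0) (w 1) *
          ((√(1 - w 0 ^ 2))⁻¹ * (√(1 - m * w 0 ^ 2))⁻¹) *
          ((√(1 - w 1 ^ 2))⁻¹ * (√(1 - m * w 1 ^ 2))⁻¹)) (Fin.snoc y b)) b := by
    intro y hy b hb
    have h : y 0 ∈ Ioo (0:ℝ) σ := hy
    have ha2 : y 0 ^ 2 ≤ 1 := by nlinarith [h.1, h.2, hσ.2]
    have hb2 : b ^ 2 < 1 := by nlinarith [hb.1, hb.2]
    simp only [snoc0, snoc1]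
    exact soloInformed_kummerZetaPhi_hasDerivAt hm ha2 hb2
  have h0 : ∀ y ∈ {y : Fin 1 → ℝ | y 0 ∈ Ioo (0:ℝ) σ},
      (fun w : Fin 2 → ℝ => soloInformedKummerZetaPhi m (w 0) (w 1)) (Fin.snoc y 1) -
        (fun w : Fin 2 → ℝ => soloInformedKummerZetaPhi m (w 0) (w 1)) (Fin.snoc y 0) = 0 := by
    intro y _
    simp only [snoc0, snoc1, soloInformed_kummerZetaPhi_right_zero,
      soloInformed_kummerZetaPhi_right_one, sub_zero]
  have he0 : Equiv.swap (0 : Fin 2) 1 0 = 1 := by decide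
  have he1 : Equiv.swap (0 : Fin 2) 1 1 = 0 := by decide
  obtain ⟨T, hTd, hTi, hT⟩ := soloInformed_kummerZeta_kill _ hB₂ _ _ hP hg hcont hder hint h0
    (Equiv.swap 0 1)
  refine ⟨T, ?_, ?_, hT⟩
  · rw [hTd]
    ext w
    simp only [mem_setOf_eq, Fin.init, Fin.castSucc_zero, hl, he0, he1, mem_Ioo]
    constructor
    · rintro ⟨h1, h2, h3⟩; exact ⟨⟨h2, h3⟩, h1⟩
    · rintro ⟨⟨h2, h3⟩, h1⟩; exact ⟨h1, h2, h3⟩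
  · rw [hTi]
    funext w
    simp only [he0, he1]

end Summit.KontsevichZagierPeriods.KontsevichZagierPeriods.Theorems

end
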